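import Literature.AnabelianGeometry.EtaleTheta.Discharge.Sec5Prop55OfRoofs
import Literature.AnabelianGeometry.EtaleTheta.Discharge.Sec5Prop55OfLaws
import Literature.AnabelianGeometry.SemiGraphs.TemperoidsGaloisHomTorsor
import HarnessLib

/-!
# [EtTh] Prop. 5.5 by ROOFS `S″ → S`, `S″ → B_N`: the roof-independence «independent of the choice of `S″` … and the
# linear morphisms» DERIVED from the laws of the §5 datum, and Prop. 5.5 re-assembled in roof form (proof-only)

S. Mochizuki, *The étale theta function and its Frobenioid-theoretic manifestations*, Publ. RIMS **45** (2009)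
[MochizukiEtTh2009], proof of Prop. 5.5, p.328 (PDF p.102) l.2–11: «we may transport this isomorphism from `S′` to an
arbitrary `(l, N)`-theta-saturated `S ∈ Ob(C)` by means of linear morphisms `S″ → S`, `S″ → S′` [of `C` — cf. [FrdI],
Definition 1.3, (i), (b)], which induce isomorphisms … — hence also a [functorial] isomorphism `(l·Δ_Θ)_S ⊗ ℤ/Nℤ ⥲
μ_N(S)`, which is independent of the choice of `S′`, `S″`, and the linear morphisms `S″ → S`, `S″ → S′` [precisely
because of the original "functoriality" of the isomorphism for `S′`]»; p.331 (PDF p.105): «`B_N^bs` is Galois»;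
S. Mochizuki, *Semi-graphs of anabelioids*, Publ. RIMS **42** (2006) [MochizukiSemiAnbd2006], Def. 3.1 (iv) p.33 (a connected
`T` is Galois iff for any two arrows `ψ₁, ψ₂ : S → T`, `S` connected, `ψ₁ = α ∘ ψ₂` for some `α ∈ Aut(T)`).

abc-iut cell, layer L2, seat abc-iut-w5-d013 (gen 6), row R521 (abc-iut-L2-lead 2026-08-26T16:37Z); sequel of this seat's
`Sec5Prop55OfRoofs.lean` (p453687: Prop. 5.5 from roofs MODULO the roof-independence binder `hind`) and of the finding
F-w5d013g5-1 (`Sec5ReachableFromBNForcesDepth.lean`: the fixed-source binder `hreach : (Bijectively)LinearlyReachableFromBN` is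
a DEPTH constraint; abc-iut-L2-t4's audit INFO-1 on p449776: «closer-of-record status should migrate to the roof form … one-binder
swap at the K4 chain head»).  PROOF-ONLY (no definition, no new named fact): every input is a hypothesis binder written out in
the signature, exactly as in abc-iut-w4-d008's fixed-source `transportIndependent_of` / `cyclotomicRigidity_of_laws`, which this
file mirrors with print's TWO arrows; nothing landed is edited or restated.

WHAT IS PROVED (namespace `ThetaFrobenioid.Thm56Sub`, abstract §5 datum `𝔉 : ThetaFrobenioid C D`):
* `roofIndependent_of` — the ROOF-INDEPENDENCE of the transport of `ν : (l·Δ_Θ)_{B_N} ⊗ ℤ/Nℤ ⥲ μ_N(B_N)` (the binder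
  `hind` of `rigidityFamily_exists_of_roofs`, at roofs whose `T`-leg is injective on `(l·Δ_Θ) ⊗ ℤ/Nℤ` — «which induce
  isomorphisms»), DERIVED from: (M) `hmeet` — two roofs `R → T`, `R′ → T` from theta-saturated objects MEET: a theta-saturated
  `R″` with linear `c : R″ → R`, `c′ : R″ → R′`, ONE composite base map `(c ≫ a)^bs = (c′ ≫ a′)^bs`, `Δ-push(c′)` onto and
  `μ-pull(c′)` injective (the evident common refinement implicit in «independent of the choice of `S″`»; at the genuine base a
  connected component of `R^bs ×_{T^bs} R′^bs`, linear legs by [FrdI] Def. 1.3 (i)(b)); (G-in) `hgalIn` — the base maps of two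
  linear `R″ → B_N` differ by POST-composition with an element of `Aut_D(B_N^bs)` — VERBATIM the defining clause of «Galois»
  ([SemiAnbd] Def. 3.1 (iv), the tree's `SemiGraphs.IsGaloisObj`) for `B_N^bs` («`B_N^bs` is Galois», p.331), PROVED below over
  the genuine base `B^temp(Π)⁰` (`galoisIn_of_isGaloisObj_connectedPart`); (S) `hsec` — `s^⊓-gp_N` is a section (the tree's
  `SgpCapSection`); (U) `hUb` — the unit pull-back along a linear morphism depends only on its base morphism ([FrdI] Def. 1.3
  (i)(b); theorem at `ofModel`: abc-iut-w4-d008's `ofModel_unitsPull_congr_base`); (F) `hfun` — «the original "functoriality" of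
  the isomorphism for `S′`» along the lifts `s^⊓-gp_N(g)` (a THEOREM for the Kummer-pinned `ν`: abc-iut-w4-d008's
  `autFunctorial_sgpCap_of_kummerShape` + `kummerShape_of_thetaPair`); and the composition laws P55-L06b.
  Algebra: lift `x′ = c′_* x″`; injectivity of `a_*` gives `c_* x″ = x`; the legs `c ≫ b`, `c′ ≫ b′ : R″ → B_N` differ on
  bases by `g`, so `c′ ≫ b′` and `c ≫ b ≫ s^⊓-gp_N(g)` have the same two transports ((U), `lDeltaModNMap_congr_base`); apply
  (F) and cancel `μ-pull(c′)`.
* `rigidityFamily_exists_of_roofs'` — the existence half from roofs with `hind` asked only at `Δ`-injective roofs (the two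
  uses in `rigidityFamily_exists_of_roofs` are at the chosen bijective roof); `rigidityFamily_exists_of_laws_roofs` — the
  existence half from `hroof` + (M) + (G-in) + (S) + (U) + (F) + laws, NO independence binder;
* `cyclotomicRigidity_of_laws_roofs` — **abc-iut-L2-t4's `CyclotomicRigidity P hB` ([EtTh] Prop. 5.5, existence ∧ uniqueness)
  = abc-iut-w4-d008's `cyclotomicRigidity_of_laws` with the depth-constrained P55-L05 `BijectivelyReachableFromBN` REPLACED by
  print's roofs `hroof` + (M), and the out-transitivity (G) at `B_N ⟶ T` replaced by the in-transitivity (G-in) at `R″ ⟶ B_N`**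
  — the chain-head theorem for the «hreach → roof» swap (K4 md v4.3); remaining named inputs: Prop. 5.2 (iii) pin `hK`, P55-L02
  `hη`, P55-L02b `hcentral`, laws P55-L06b / T56-L09d `hspec`, coverage `hcov`, (S), (U), `hproj`, `hcup` — all as in
  `cyclotomicRigidity_of_laws` — plus `hroof`, `hmeet`, `hgalIn`.
* Back-compatibility (the roof inputs are WEAKER than the fixed-source ones): `roofs_of_bijectivelyReachableFromBN` (`hroof` ⟸
  `hreach` with the trivial leg `𝟙 B_N`) and `roofsMeet_of_bijectivelyReachableFromBN` ((M) ⟸ `hreach` + (G) + (S): the two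
  roofs meet at `R″ := B_N`); and the discharge of (G-in) over `D = B^temp(Π)⁰`: `SemiGraphs.GaloisObjects.
  exists_comp_aut_eq_of_isGaloisObj_connectedPart`, `galoisIn_of_isGaloisObj_connectedPart`.
HONEST FRAMING: kernel-checked implications between typed statements about the abstract §5 data; `hroof`, (M), (S), (U), `hproj`,
`hcup`, the pin and the laws are HYPOTHESES (what the genuine instance supplies or must supply), not asserted; nothing asserts that
such data exist for an actual curve; [EtTh]/[SemiAnbd] are refereed pre-IUT material; nothing here bears on [IUTchIII] Cor. 3.12 —
no side is taken; typed ≠ proved.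
-/

namespace Literature.AnabelianGeometry.EtaleTheta

open CategoryTheory FrobenioidCyclotomicRigidity

universe w v v' u u'

namespace ThetaFrobenioid

namespace Thm56Sub

variable {C : Type u} [Category.{v} C] {D : Type u'} [Category.{v'} D] {𝔉 : ThetaFrobenioid.{w} C D}

/-! ### The roof-independence from the laws -/

/-- **[EtTh] Prop. 5.5, the ROOF-INDEPENDENCE of the transport DERIVED** («independent of the choice of `S′`, `S″`, and the
linear morphisms `S″ → S`, `S″ → S′` [precisely because of the original "functoriality" of the isomorphism for `S′`]», p.328
(PDF p.102) l.8–11) — the binder `hind` of `rigidityFamily_exists_of_roofs` at roofs `B_N ⟵b R a⟶ T` whose `T`-leg `a` is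
injective on `(l·Δ_Θ) ⊗ ℤ/Nℤ` («which induce isomorphisms», l.5–7): for a second roof `B_N ⟵b′ R′ a′⟶ T`, `x`, `x′`, `u` with
`a_* x = a′_* x′` and `a^* u = b^* ν(b_* x)`, also `a′^* u = b′^* ν(b′_* x′)`.  From: (M) `hmeet` (the two roofs meet at a
theta-saturated `R″` over one base map to `T^bs`, the `R′`-leg onto on `(l·Δ_Θ) ⊗ ℤ/Nℤ` and injective on `μ_N`), (G-in) `hgalIn`
(«`B_N^bs` is Galois», p.331: in-transitivity on bases of linear `R″ → B_N`), (S) `hsec`, (U) `hUb`, (F) `hfun` (functoriality of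
`ν` along the lifts `s^⊓-gp_N(g)`), laws P55-L06b.  [cite: MochizukiEtTh2009, Prop 5.5 proof p.328 (PDF p.102)]
[cite: MochizukiSemiAnbd2006, Def 3.1(iv) p.33] -/
theorem roofIndependent_of (hUc : UnitsPullComp 𝔉) (hLc : LDeltaMapComp 𝔉)
    (ν : 𝔉.lDeltaModN 𝔉.BN ≃* 𝔉.muTorsion 𝔉.BN 𝔉.N)
    (hUb : ∀ {S T : C} (φ ψ : S ⟶ T), 𝔉.IsLinear φ → 𝔉.IsLinear ψ → 𝔉.base.map φ = 𝔉.base.map ψ →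
      𝔉.unitsPull φ = 𝔉.unitsPull ψ)
    (hsec : 𝔉.SgpCapSection)
    (hgalIn : ∀ (R : C), 𝔉.IsThetaSaturated R → ∀ (φ φ' : R ⟶ 𝔉.BN), 𝔉.IsLinear φ → 𝔉.IsLinear φ' →
      ∃ g : Aut (𝔉.base.obj 𝔉.BN), 𝔉.base.map φ' = 𝔉.base.map φ ≫ g.hom)
    (hfun : ∀ (g : Aut (𝔉.base.obj 𝔉.BN)) (x : 𝔉.lDeltaModN 𝔉.BN),
      𝔉.muTorsionPull (𝔉.sgpCap g).hom 𝔉.N (ν (𝔉.lDeltaModNMap (𝔉.sgpCap g).hom x)) = ν x)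
    (hmeet : ∀ (T : C), 𝔉.IsThetaSaturated T → ∀ (R : C), 𝔉.IsThetaSaturated R → ∀ (a : R ⟶ T), 𝔉.IsLinear a →
      ∀ (R' : C), 𝔉.IsThetaSaturated R' → ∀ (a' : R' ⟶ T), 𝔉.IsLinear a' →
      ∃ (R'' : C) (_ : 𝔉.IsThetaSaturated R'') (c : R'' ⟶ R) (c' : R'' ⟶ R'),
        𝔉.IsLinear c ∧ 𝔉.IsLinear c' ∧ 𝔉.base.map (c ≫ a) = 𝔉.base.map (c' ≫ a') ∧
          Function.Surjective (𝔉.lDeltaModNMap c') ∧ Function.Injective (𝔉.muTorsionPull c' 𝔉.N))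
    (T : C) (hT : 𝔉.IsThetaSaturated T) (R : C) (hR : 𝔉.IsThetaSaturated R) (a : R ⟶ T) (b : R ⟶ 𝔉.BN)
    (ha : 𝔉.IsLinear a) (hb : 𝔉.IsLinear b) (hΔa : Function.Injective (𝔉.lDeltaModNMap a))
    (R' : C) (hR' : 𝔉.IsThetaSaturated R') (a' : R' ⟶ T) (b' : R' ⟶ 𝔉.BN) (ha' : 𝔉.IsLinear a')
    (hb' : 𝔉.IsLinear b') (x : 𝔉.lDeltaModN R) (x' : 𝔉.lDeltaModN R') (u : 𝔉.muTorsion T 𝔉.N)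
    (hΔ : 𝔉.lDeltaModNMap a x = 𝔉.lDeltaModNMap a' x')
    (hμ : 𝔉.muTorsionPull a 𝔉.N u = 𝔉.muTorsionPull b 𝔉.N (ν (𝔉.lDeltaModNMap b x))) :
    𝔉.muTorsionPull a' 𝔉.N u = 𝔉.muTorsionPull b' 𝔉.N (ν (𝔉.lDeltaModNMap b' x')) := by
  obtain ⟨R'', hR'', c, c', hc, hc', hbase, hΔc', hμc'⟩ := hmeet T hT R hR a ha R' hR' a' ha'
  -- lift `x′` along `c′`
  obtain ⟨x'', rfl⟩ := hΔc' x'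
  -- `a_*` injective and one base map over `T^bs`: `c_* x″ = x`
  have hx : 𝔉.lDeltaModNMap c x'' = x := by
    apply hΔa
    rw [← lDeltaModNMap_comp hLc, lDeltaModNMap_congr_base hbase, lDeltaModNMap_comp hLc, hΔ]
  -- the legs `c ≫ b`, `c′ ≫ b′ : R″ → B_N` differ on bases by `g ∈ Aut_D(B_N^bs)`; lift it by `s^⊓-gp_N`
  obtain ⟨g, hg⟩ := hgalIn R'' hR'' (c ≫ b) (c' ≫ b') (isLinear_comp hc hb) (isLinear_comp hc' hb')
  have hαb : 𝔉.base.map (𝔉.sgpCap g).hom = g.hom := congrArg Iso.hom (hsec g)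
  have hb₂ : 𝔉.base.map (c' ≫ b') = 𝔉.base.map ((c ≫ b) ≫ (𝔉.sgpCap g).hom) := by
    rw [𝔉.base.map_comp (c ≫ b) (𝔉.sgpCap g).hom, hαb, hg]
  have hlin₂ : 𝔉.IsLinear ((c ≫ b) ≫ (𝔉.sgpCap g).hom) :=
    isLinear_comp (isLinear_comp hc hb) (𝔉.isLinear_of_aut _)
  -- cancel `μ-pull(c′)` and compute both sides at `R″`
  apply hμc'
  rw [← muTorsionPull_comp hUc, ← muTorsionPull_comp hUc,
    muTorsionPull_congr (hUb (c' ≫ a') (c ≫ a) (isLinear_comp hc' ha') (isLinear_comp hc ha) hbase.symm),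
    muTorsionPull_comp hUc c a, hμ, ← muTorsionPull_comp hUc, ← lDeltaModNMap_comp hLc,
    lDeltaModNMap_congr_base hb₂, muTorsionPull_congr (hUb (c' ≫ b') ((c ≫ b) ≫ (𝔉.sgpCap g).hom)
      (isLinear_comp hc' hb') hlin₂ hb₂),
    lDeltaModNMap_comp hLc (c ≫ b) (𝔉.sgpCap g).hom, muTorsionPull_comp hUc (c ≫ b) (𝔉.sgpCap g).hom, hfun g,
    lDeltaModNMap_comp hLc c b, hx]

/-! ### Prop. 5.5 from roofs, re-assembled -/

/-- **Prop. 5.5, EXISTENCE half, from ROOFS — with the roof-independence asked only at `Δ`-injective roofs** (the two uses of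
`hind` in this seat's `rigidityFamily_exists_of_roofs` are at the chosen roof, whose legs are bijective): `ρ_S := (a^*)⁻¹ ∘ b^*
∘ ν ∘ b_* ∘ (a_*)⁻¹` along a chosen roof of `S`, extending `ν` and functorial for linear morphisms.
[cite: MochizukiEtTh2009, Prop 5.5 proof p.328 (PDF p.102)] -/
theorem rigidityFamily_exists_of_roofs' (hB : 𝔉.IsThetaSaturated 𝔉.BN)
    (ν : 𝔉.lDeltaModN 𝔉.BN ≃* 𝔉.muTorsion 𝔉.BN 𝔉.N)
    (hroof : ∀ S : C, 𝔉.IsThetaSaturated S → ∃ (R : C) (_ : 𝔉.IsThetaSaturated R) (a : R ⟶ S) (b : R ⟶ 𝔉.BN),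
      𝔉.IsLinear a ∧ 𝔉.IsLinear b ∧ Function.Bijective (𝔉.lDeltaModNMap a) ∧ Function.Bijective (𝔉.muTorsionPull a 𝔉.N) ∧
        Function.Bijective (𝔉.lDeltaModNMap b) ∧ Function.Bijective (𝔉.muTorsionPull b 𝔉.N))
    (hind : ∀ (T : C), 𝔉.IsThetaSaturated T →
      ∀ (R : C), 𝔉.IsThetaSaturated R → ∀ (a : R ⟶ T) (b : R ⟶ 𝔉.BN), 𝔉.IsLinear a → 𝔉.IsLinear b →
      Function.Injective (𝔉.lDeltaModNMap a) →
      ∀ (R' : C), 𝔉.IsThetaSaturated R' → ∀ (a' : R' ⟶ T) (b' : R' ⟶ 𝔉.BN), 𝔉.IsLinear a' → 𝔉.IsLinear b' →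
      ∀ (x : 𝔉.lDeltaModN R) (x' : 𝔉.lDeltaModN R') (u : 𝔉.muTorsion T 𝔉.N),
        𝔉.lDeltaModNMap a x = 𝔉.lDeltaModNMap a' x' →
        𝔉.muTorsionPull a 𝔉.N u = 𝔉.muTorsionPull b 𝔉.N (ν (𝔉.lDeltaModNMap b x)) →
        𝔉.muTorsionPull a' 𝔉.N u = 𝔉.muTorsionPull b' 𝔉.N (ν (𝔉.lDeltaModNMap b' x')))
    (hUc : UnitsPullComp 𝔉) (hUi : UnitsPullId 𝔉) (hLc : LDeltaMapComp 𝔉) (hLi : LDeltaMapId 𝔉) :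
    ∃ ρ : RigidityFamily 𝔉, (∀ x, ρ 𝔉.BN hB x = ν x) ∧ IsFunctorialLinear 𝔉 ρ := by
  classical
  choose R hR a b ha hb hΔa hμa hΔb hμb using hroof
  -- the four induced isomorphisms along the legs of the chosen roof of `S`
  let EΔa : ∀ S (hS : 𝔉.IsThetaSaturated S), 𝔉.lDeltaModN (R S hS) ≃* 𝔉.lDeltaModN S := fun S hS =>
    MulEquiv.ofBijective (𝔉.lDeltaModNMap (a S hS)) (hΔa S hS)
  let Eμa : ∀ S (hS : 𝔉.IsThetaSaturated S), 𝔉.muTorsion S 𝔉.N ≃* 𝔉.muTorsion (R S hS) 𝔉.N := fun S hS =>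
    MulEquiv.ofBijective (𝔉.muTorsionPull (a S hS) 𝔉.N) (hμa S hS)
  let EΔb : ∀ S (hS : 𝔉.IsThetaSaturated S), 𝔉.lDeltaModN (R S hS) ≃* 𝔉.lDeltaModN 𝔉.BN := fun S hS =>
    MulEquiv.ofBijective (𝔉.lDeltaModNMap (b S hS)) (hΔb S hS)
  let Eμb : ∀ S (hS : 𝔉.IsThetaSaturated S), 𝔉.muTorsion 𝔉.BN 𝔉.N ≃* 𝔉.muTorsion (R S hS) 𝔉.N := fun S hS =>
    MulEquiv.ofBijective (𝔉.muTorsionPull (b S hS) 𝔉.N) (hμb S hS)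
  -- `ρ_S := (a^*)⁻¹ ∘ b^* ∘ ν ∘ b_* ∘ (a_*)⁻¹`
  let ρ : RigidityFamily 𝔉 := fun S hS =>
    ((((EΔa S hS).symm.trans (EΔb S hS)).trans ν).trans (Eμb S hS)).trans (Eμa S hS).symm
  -- its defining relation, read through the chosen roof
  have hchar : ∀ S (hS : 𝔉.IsThetaSaturated S) (y : 𝔉.lDeltaModN S),
      𝔉.muTorsionPull (a S hS) 𝔉.N (ρ S hS y) =
        𝔉.muTorsionPull (b S hS) 𝔉.N (ν (𝔉.lDeltaModNMap (b S hS) ((EΔa S hS).symm y))) := by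
    intro S hS y
    change (Eμa S hS) ((Eμa S hS).symm ((Eμb S hS) (ν ((EΔb S hS) ((EΔa S hS).symm y))))) = _
    rw [MulEquiv.apply_symm_apply]
    rfl
  have hEΔa : ∀ S (hS : 𝔉.IsThetaSaturated S) (y : 𝔉.lDeltaModN S),
      𝔉.lDeltaModNMap (a S hS) ((EΔa S hS).symm y) = y := fun S hS y => (EΔa S hS).apply_symm_apply y
  refine ⟨ρ, ?_, ?_⟩
  · -- at `B_N`: compare the chosen roof of `B_N` with the trivial roof `(B_N, 𝟙, 𝟙)` (roof-independence)
    intro x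
    have key := hind 𝔉.BN hB (R 𝔉.BN hB) (hR 𝔉.BN hB) (a 𝔉.BN hB) (b 𝔉.BN hB) (ha 𝔉.BN hB) (hb 𝔉.BN hB)
      (hΔa 𝔉.BN hB).1 𝔉.BN hB (𝟙 𝔉.BN) (𝟙 𝔉.BN) (𝔉.pre.degFr_id 𝔉.BN) (𝔉.pre.degFr_id 𝔉.BN)
      ((EΔa 𝔉.BN hB).symm x) x (ρ 𝔉.BN hB x) (by rw [hEΔa, lDeltaModNMap_id hLi]) (hchar 𝔉.BN hB x)
    rw [muTorsionPull_id hUi, lDeltaModNMap_id hLi, muTorsionPull_id hUi] at key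
    exact key
  · -- functoriality for a linear `ψ : S → T`: roof-independence at `T` between `T`'s roof and `(R_S, a_S ≫ ψ, b_S)`
    intro S T ψ hψ hS hT x
    set x₁ := (EΔa S hS).symm x with hx₁
    have hx : 𝔉.lDeltaModNMap (a S hS) x₁ = x := hEΔa S hS x
    have key := hind T hT (R T hT) (hR T hT) (a T hT) (b T hT) (ha T hT) (hb T hT) (hΔa T hT).1
      (R S hS) (hR S hS) (a S hS ≫ ψ) (b S hS) (isLinear_comp (ha S hS) hψ) (hb S hS)
      ((EΔa T hT).symm (𝔉.lDeltaModNMap ψ x)) x₁ (ρ T hT (𝔉.lDeltaModNMap ψ x))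
      (by rw [hEΔa, lDeltaModNMap_comp hLc, hx]) (hchar T hT _)
    rw [muTorsionPull_comp hUc] at key
    -- `a_S^*` is injective: compare with `a_S^* (ρ_S x) = b_S^* (ν (b_{S*} x₁))`
    apply (hμa S hS).1
    rw [key, hchar S hS x]

/-- **Prop. 5.5, EXISTENCE half, from ROOFS and the laws — NO independence binder**: `rigidityFamily_exists_of_roofs'` with
`hind` DISCHARGED by `roofIndependent_of`.  Inputs: `ν`, `hroof`, (M) `hmeet`, (G-in) `hgalIn`, (S) `hsec`, (U) `hUb`, (F) `hfun`,
laws P55-L06b.  [cite: MochizukiEtTh2009, Prop 5.5 proof p.328 (PDF p.102)] -/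
theorem rigidityFamily_exists_of_laws_roofs (hB : 𝔉.IsThetaSaturated 𝔉.BN)
    (ν : 𝔉.lDeltaModN 𝔉.BN ≃* 𝔉.muTorsion 𝔉.BN 𝔉.N)
    (hroof : ∀ S : C, 𝔉.IsThetaSaturated S → ∃ (R : C) (_ : 𝔉.IsThetaSaturated R) (a : R ⟶ S) (b : R ⟶ 𝔉.BN),
      𝔉.IsLinear a ∧ 𝔉.IsLinear b ∧ Function.Bijective (𝔉.lDeltaModNMap a) ∧ Function.Bijective (𝔉.muTorsionPull a 𝔉.N) ∧
        Function.Bijective (𝔉.lDeltaModNMap b) ∧ Function.Bijective (𝔉.muTorsionPull b 𝔉.N))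
    (hmeet : ∀ (T : C), 𝔉.IsThetaSaturated T → ∀ (R : C), 𝔉.IsThetaSaturated R → ∀ (a : R ⟶ T), 𝔉.IsLinear a →
      ∀ (R' : C), 𝔉.IsThetaSaturated R' → ∀ (a' : R' ⟶ T), 𝔉.IsLinear a' →
      ∃ (R'' : C) (_ : 𝔉.IsThetaSaturated R'') (c : R'' ⟶ R) (c' : R'' ⟶ R'),
        𝔉.IsLinear c ∧ 𝔉.IsLinear c' ∧ 𝔉.base.map (c ≫ a) = 𝔉.base.map (c' ≫ a') ∧
          Function.Surjective (𝔉.lDeltaModNMap c') ∧ Function.Injective (𝔉.muTorsionPull c' 𝔉.N))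
    (hgalIn : ∀ (R : C), 𝔉.IsThetaSaturated R → ∀ (φ φ' : R ⟶ 𝔉.BN), 𝔉.IsLinear φ → 𝔉.IsLinear φ' →
      ∃ g : Aut (𝔉.base.obj 𝔉.BN), 𝔉.base.map φ' = 𝔉.base.map φ ≫ g.hom)
    (hsec : 𝔉.SgpCapSection)
    (hUb : ∀ {S T : C} (φ ψ : S ⟶ T), 𝔉.IsLinear φ → 𝔉.IsLinear ψ → 𝔉.base.map φ = 𝔉.base.map ψ →
      𝔉.unitsPull φ = 𝔉.unitsPull ψ)
    (hfun : ∀ (g : Aut (𝔉.base.obj 𝔉.BN)) (x : 𝔉.lDeltaModN 𝔉.BN),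
      𝔉.muTorsionPull (𝔉.sgpCap g).hom 𝔉.N (ν (𝔉.lDeltaModNMap (𝔉.sgpCap g).hom x)) = ν x)
    (hUc : UnitsPullComp 𝔉) (hUi : UnitsPullId 𝔉) (hLc : LDeltaMapComp 𝔉) (hLi : LDeltaMapId 𝔉) :
    ∃ ρ : RigidityFamily 𝔉, (∀ x, ρ 𝔉.BN hB x = ν x) ∧ IsFunctorialLinear 𝔉 ρ :=
  rigidityFamily_exists_of_roofs' hB ν hroof (roofIndependent_of hUc hLc ν hUb hsec hgalIn hfun hmeet) hUc hUi hLc hLi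

/-- **[EtTh] Prop. 5.5 (`CyclotomicRigidity P hB`, existence ∧ uniqueness) FROM ROOFS AND THE LAWS** — abc-iut-w4-d008's
`cyclotomicRigidity_of_laws` with the fixed-source P55-L05 `BijectivelyReachableFromBN` (a depth constraint, F-w5d013g5-1) REPLACED
by print's roofs `hroof` («linear morphisms `S″ → S`, `S″ → S′` … which induce isomorphisms») and their meeting (M) `hmeet`, and the
out-transitivity (G) at `B_N ⟶ T` replaced by (G-in) at `R″ ⟶ B_N` («`B_N^bs` is Galois», [SemiAnbd] Def. 3.1 (iv) verbatim).
Existence: `rigidityFamily_exists_of_laws_roofs` with (F) from the Kummer shape of `ν` (`autFunctorial_sgpCap_of_kummerShape`,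
`kummerShape_of_thetaPair`); Kummer-determined at `B_N` by P55-L03; uniqueness: `cyclotomicRigidity_of_roofs`.  Remaining named
inputs: the Prop. 5.2 (iii) pin `hK`, P55-L02 `hη`, P55-L02b `hcentral`, the laws P55-L06b / T56-L09d `hspec`, coverage `hcov`,
(S) `hsec`, (U) `hUb`, `hproj`, `hcup` (all exactly as in `cyclotomicRigidity_of_laws`), `hroof`, `hmeet`, `hgalIn`.
[cite: MochizukiEtTh2009, Prop 5.5 p.327–328 (PDF pp.101–102)] [cite: MochizukiSemiAnbd2006, Def 3.1(iv) p.33] -/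
theorem cyclotomicRigidity_of_laws_roofs (P : ThetaSubquotientProj 𝔉) (hB : 𝔉.IsThetaSaturated 𝔉.BN)
    {η : 𝔉.HB → 𝔉.lDeltaModN 𝔉.BN} {ν : 𝔉.lDeltaModN 𝔉.BN ≃* 𝔉.muTorsion 𝔉.BN 𝔉.N}
    (hK : FrobenioidThetaBiKummer.ThetaPairKummerClass 𝔉 η ν) (hη : EtaTautological 𝔉 P η)
    (hcentral : UnitsCentralUnderLDelta 𝔉 P)
    (hroof : ∀ S : C, 𝔉.IsThetaSaturated S → ∃ (R : C) (_ : 𝔉.IsThetaSaturated R) (a : R ⟶ S) (b : R ⟶ 𝔉.BN),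
      𝔉.IsLinear a ∧ 𝔉.IsLinear b ∧ Function.Bijective (𝔉.lDeltaModNMap a) ∧ Function.Bijective (𝔉.muTorsionPull a 𝔉.N) ∧
        Function.Bijective (𝔉.lDeltaModNMap b) ∧ Function.Bijective (𝔉.muTorsionPull b 𝔉.N))
    (hmeet : ∀ (T : C), 𝔉.IsThetaSaturated T → ∀ (R : C), 𝔉.IsThetaSaturated R → ∀ (a : R ⟶ T), 𝔉.IsLinear a →
      ∀ (R' : C), 𝔉.IsThetaSaturated R' → ∀ (a' : R' ⟶ T), 𝔉.IsLinear a' →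
      ∃ (R'' : C) (_ : 𝔉.IsThetaSaturated R'') (c : R'' ⟶ R) (c' : R'' ⟶ R'),
        𝔉.IsLinear c ∧ 𝔉.IsLinear c' ∧ 𝔉.base.map (c ≫ a) = 𝔉.base.map (c' ≫ a') ∧
          Function.Surjective (𝔉.lDeltaModNMap c') ∧ Function.Injective (𝔉.muTorsionPull c' 𝔉.N))
    (hUc : UnitsPullComp 𝔉) (hUi : UnitsPullId 𝔉) (hLc : LDeltaMapComp 𝔉) (hLi : LDeltaMapId 𝔉)
    (hspec : UnitsPullSpec 𝔉) (hcov : LDeltaCovered 𝔉 P)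
    (hgalIn : ∀ (R : C), 𝔉.IsThetaSaturated R → ∀ (φ φ' : R ⟶ 𝔉.BN), 𝔉.IsLinear φ → 𝔉.IsLinear φ' →
      ∃ g : Aut (𝔉.base.obj 𝔉.BN), 𝔉.base.map φ' = 𝔉.base.map φ ≫ g.hom)
    (hsec : 𝔉.SgpCapSection)
    (hUb : ∀ {S T : C} (φ ψ : S ⟶ T), 𝔉.IsLinear φ → 𝔉.IsLinear ψ → 𝔉.base.map φ = 𝔉.base.map ψ →
      𝔉.unitsPull φ = 𝔉.unitsPull ψ)
    (hproj : ∀ (g h : Aut (𝔉.base.obj 𝔉.BN)) (hh : h ∈ P.pre (𝔉.base.obj 𝔉.BN)),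
      ∃ hgh : g * h * g⁻¹ ∈ P.pre (𝔉.base.obj 𝔉.BN),
        𝔉.lDeltaMap g.hom (P.proj _ ⟨h, hh⟩) = P.proj _ ⟨g * h * g⁻¹, hgh⟩)
    (hcup : ∀ (g : Aut (𝔉.base.obj 𝔉.BN)) (h : 𝔉.HB),
      (h : Aut (𝔉.base.obj 𝔉.BN)) ∈ P.pre (𝔉.base.obj 𝔉.BN) →
        ∃ hmem : g * (h : Aut (𝔉.base.obj 𝔉.BN)) * g⁻¹ ∈ 𝔉.HB,
          𝔉.sgpCup ⟨g * (h : Aut (𝔉.base.obj 𝔉.BN)) * g⁻¹, hmem⟩ =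
            𝔉.sgpCap g * 𝔉.sgpCup h * (𝔉.sgpCap g)⁻¹) :
    CyclotomicRigidity 𝔉 P hB := by
  have hc : CyclotomeCentralUnderLDelta 𝔉 P := cyclotomeCentral_of_unitsCentral 𝔉 hcentral
  obtain ⟨ρ, hρB, hρ⟩ := rigidityFamily_exists_of_laws_roofs hB ν hroof hmeet hgalIn hsec hUb
    (autFunctorial_sgpCap_of_kummerShape hspec hsec P hcov ν (kummerShape_of_thetaPair P hK hη hc) hproj hcup)
    hUc hUi hLc hLi
  have hroof' : ∀ S : C, 𝔉.IsThetaSaturated S → ∃ (R : C) (_ : 𝔉.IsThetaSaturated R) (b : R ⟶ 𝔉.BN) (a : R ⟶ S),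
      𝔉.IsLinear b ∧ 𝔉.IsLinear a ∧ Function.Surjective (𝔉.lDeltaModNMap a) ∧
        Function.Injective (𝔉.muTorsionPull a 𝔉.N) := fun S hS => by
    obtain ⟨R, hR, a, b, ha, hb, hΔa, hμa, -, -⟩ := hroof S hS
    exact ⟨R, hR, b, a, hb, ha, hΔa.2, hμa.1⟩
  exact cyclotomicRigidity_of_roofs P hB hroof' hcov ⟨ρ, isKummerDetermined_of_thetaPair 𝔉 P hK hη hc ρ hB hρB, hρ⟩

/-! ### Back-compatibility: the roof inputs from the fixed-source ones -/

/-- `hroof` ⟸ P55-L05 `BijectivelyReachableFromBN`: the roof `B_N ⟵𝟙 B_N φ_S⟶ S` (so the roof form is WEAKER as a hypothesis;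
the identity leg is bijective by the laws P55-L06b).  [cite: MochizukiEtTh2009, Prop 5.5 proof p.328 (PDF p.102)] -/
theorem roofs_of_bijectivelyReachableFromBN (hreach : BijectivelyReachableFromBN 𝔉) (hB : 𝔉.IsThetaSaturated 𝔉.BN)
    (hUi : UnitsPullId 𝔉) (hLi : LDeltaMapId 𝔉) (S : C) (hS : 𝔉.IsThetaSaturated S) :
    ∃ (R : C) (_ : 𝔉.IsThetaSaturated R) (a : R ⟶ S) (b : R ⟶ 𝔉.BN),
      𝔉.IsLinear a ∧ 𝔉.IsLinear b ∧ Function.Bijective (𝔉.lDeltaModNMap a) ∧ Function.Bijective (𝔉.muTorsionPull a 𝔉.N) ∧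
        Function.Bijective (𝔉.lDeltaModNMap b) ∧ Function.Bijective (𝔉.muTorsionPull b 𝔉.N) := by
  obtain ⟨φ, hφ, hΔ, hμ⟩ := hreach S hS
  refine ⟨𝔉.BN, hB, φ, 𝟙 𝔉.BN, hφ, 𝔉.pre.degFr_id 𝔉.BN, hΔ, hμ, ⟨fun y z h => ?_, fun y => ⟨y, lDeltaModNMap_id hLi _ y⟩⟩,
    ⟨fun m n h => ?_, fun m => ⟨m, muTorsionPull_id hUi _ _ m⟩⟩⟩
  · rwa [lDeltaModNMap_id hLi, lDeltaModNMap_id hLi] at h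
  · rwa [muTorsionPull_id hUi, muTorsionPull_id hUi] at h

/-- (M) `hmeet` ⟸ P55-L05 `BijectivelyReachableFromBN` + (G) out-transitivity at `B_N ⟶ T` (abc-iut-w4-d008's `hgal`) + (S)
`SgpCapSection`: two roofs of `T` meet at `R″ := B_N` through `s^⊓-gp_N(g) ≫ φ_R` and `φ_{R′}`, `g` the Galois discrepancy of
the two composite base maps `B_N^bs → T^bs`.  [cite: MochizukiEtTh2009, Prop 5.5 proof p.328 (PDF p.102)] -/
theorem roofsMeet_of_bijectivelyReachableFromBN (hreach : BijectivelyReachableFromBN 𝔉) (hB : 𝔉.IsThetaSaturated 𝔉.BN)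
    (hsec : 𝔉.SgpCapSection)
    (hgal : ∀ (T : C), 𝔉.IsThetaSaturated T → ∀ (φ φ' : 𝔉.BN ⟶ T), 𝔉.IsLinear φ → 𝔉.IsLinear φ' →
      ∃ g : Aut (𝔉.base.obj 𝔉.BN), 𝔉.base.map φ' = g.hom ≫ 𝔉.base.map φ)
    (T : C) (hT : 𝔉.IsThetaSaturated T) (R : C) (hR : 𝔉.IsThetaSaturated R) (a : R ⟶ T) (ha : 𝔉.IsLinear a)
    (R' : C) (hR' : 𝔉.IsThetaSaturated R') (a' : R' ⟶ T) (ha' : 𝔉.IsLinear a') :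
    ∃ (R'' : C) (_ : 𝔉.IsThetaSaturated R'') (c : R'' ⟶ R) (c' : R'' ⟶ R'),
      𝔉.IsLinear c ∧ 𝔉.IsLinear c' ∧ 𝔉.base.map (c ≫ a) = 𝔉.base.map (c' ≫ a') ∧
        Function.Surjective (𝔉.lDeltaModNMap c') ∧ Function.Injective (𝔉.muTorsionPull c' 𝔉.N) := by
  obtain ⟨φ, hφ, -, -⟩ := hreach R hR
  obtain ⟨φ', hφ', hΔ', hμ'⟩ := hreach R' hR'
  obtain ⟨g, hg⟩ := hgal T hT (φ ≫ a) (φ' ≫ a') (isLinear_comp hφ ha) (isLinear_comp hφ' ha')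
  have hαb : 𝔉.base.map (𝔉.sgpCap g).hom = g.hom := congrArg Iso.hom (hsec g)
  refine ⟨𝔉.BN, hB, (𝔉.sgpCap g).hom ≫ φ, φ', isLinear_comp (𝔉.isLinear_of_aut _) hφ, hφ', ?_, hΔ'.2, hμ'.1⟩
  rw [Category.assoc, 𝔉.base.map_comp (𝔉.sgpCap g).hom (φ ≫ a), hαb, hg]

end Thm56Sub

end ThetaFrobenioid

end Literature.AnabelianGeometry.EtaleTheta

/-! ### (G-in) over the genuine base `B^temp(Π)⁰`: the defining clause of «Galois» ([SemiAnbd] Def. 3.1 (iv)) -/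

namespace Literature.AnabelianGeometry.SemiGraphs

namespace GaloisObjects

open CategoryTheory
open Literature.AlgebraicGeometry.Frobenioids (IsConnectedObj ConnectedPart connectedObjects)

universe u₀

variable {G : Type u₀} [Group G] [TopologicalSpace G]

/-- **Transitivity by POST-composition INTO a Galois object, in `B^temp(Π)⁰`** — the defining clause of [SemiAnbd] Def. 3.1 (iv)
(the tree's `IsGaloisObj`: «for any two arrows `ψ₁, ψ₂ : S → T`, where `S` is connected, there exists `α ∈ Aut(T)` such that
`ψ₁ = α ∘ ψ₂`») read in the full subcategory of connected objects, where every source is connected: for `A.obj` Galois and any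
`ψ₁, ψ₂ : R ⟶ A` of `B^temp(Π)⁰`, `ψ₁ = ψ₂ ≫ α` for some `α ∈ Aut(A)`.  [cite: MochizukiSemiAnbd2006, Def 3.1(iv) p.33] -/
theorem exists_comp_aut_eq_of_isGaloisObj_connectedPart (R A : ConnectedPart (BTemp G)) (hA : IsGaloisObj A.obj)
    (ψ₁ ψ₂ : R ⟶ A) : ∃ α : Aut A, ψ₁ = ψ₂ ≫ α.hom := by
  obtain ⟨α, hα⟩ := hA.2 R.obj R.property ψ₁.hom ψ₂.hom
  exact ⟨(connectedObjects (BTemp G)).isoMk α, ObjectProperty.hom_ext _ hα⟩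

end GaloisObjects

end Literature.AnabelianGeometry.SemiGraphs

namespace Literature.AnabelianGeometry.EtaleTheta

namespace ThetaFrobenioid

open CategoryTheory Literature.AlgebraicGeometry.Frobenioids Literature.AnabelianGeometry.SemiGraphs

universe w u₀ v' u'

variable {G : Type u₀} [Group G] [TopologicalSpace G] {C : Type u'} [Category.{v'} C]
  (𝔉 : ThetaFrobenioid.{w} C (ConnectedPart (BTemp G)))

/-- **(G-in) DISCHARGED over the genuine base `D = B^temp(Π)⁰`** ([EtTh] Def. 3.6 (ii); §5 p.331 (PDF p.105) «`B_N^bs` is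
Galois»): if `B_N^bs` is a Galois object of `B^temp(Π)` (at the genuine §5 data: abc-iut-L2-t4 lineage's
`isGaloisObj_base_BN_obj_ofConnectedTemperoidData` / `BiKummerSetting.NthRoot.isGaloisObj_BN_base_obj`), then the base maps of ANY
two morphisms `R ⟶ B_N` of `C` differ by post-composition with an element of `Aut_D(B_N^bs)` — in particular the binder `hgalIn`
of `roofIndependent_of` / `cyclotomicRigidity_of_laws_roofs` (whose saturation and linearity premises are not needed here).
[cite: MochizukiEtTh2009, §5 p.331 (PDF p.105)] [cite: MochizukiSemiAnbd2006, Def 3.1(iv) p.33] -/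
theorem galoisIn_of_isGaloisObj_connectedPart (hA : IsGaloisObj (𝔉.base.obj 𝔉.BN).obj) (R : C) (φ φ' : R ⟶ 𝔉.BN) :
    ∃ g : Aut (𝔉.base.obj 𝔉.BN), 𝔉.base.map φ' = 𝔉.base.map φ ≫ g.hom :=
  GaloisObjects.exists_comp_aut_eq_of_isGaloisObj_connectedPart _ _ hA _ _

end ThetaFrobenioid

end Literature.AnabelianGeometry.EtaleTheta
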